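import Literature.Probability.Percolation.TwoClusterExchange
import HarnessLib

/-!
# `NoHeavyLowerTail` (stmt-CriticalPhenomena-4575), one-cut / cumulative-isolation line —
# the MERGE LEMMA at level 2 (the first genuinely level-2 comparison, from BHK 2006 Thm 1.5)

Bond percolation with arbitrary edge probabilities on `Fin n` (`μ = prodBernoulli w`), a relay set `A`.
For a relay `v` write `T_v = {u ∈ A : v ↔ u}` (the relay class of `v`, containing `v`) and call `v`
SMALL if `|T_v| ≤ 2`.  The cumulative-isolation / cluster-size-transfer line (stubs
`stub_cumulativeIsolation`, `stub_championStabilityPair`, `stub_mergeStability` of the crux) asks, at its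
first open level `j = 2`, for comparisons between the CHAMPION `a` (a relay maximising `P(T_a small)`)
and GLUED groups of relays: conditioning on the relays `R` joined directly to an observer `o` replaces
`o` by the glued group `R`, and the one-cut margin becomes `Σ_R P(R)·[P'(a small) − P'(R small)]`
(primes: the graph with `R` glued).

* `mergeLemma_two` — **MERGE LEMMA (level 2).**  If `a, x, y ∈ A` are distinct relays and
  `P(x small) ≤ P(a small)`, `P(y small) ≤ P(a small)`, then

    `P(T_x ∪ T_y ⊆ {x, y})  ≤  P(a small, x ↮ a, y ↮ a)`,

  which is exactly `P'(xy small) ≤ P'(a small)` in the graph where `x` and `y` are glued: the champion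
  still beats the glued pair.  This is NOT a consequence of the two hypotheses at the level of partition
  laws (a fake law puts mass `1/3` on each of `ax|yB`, `aB|xy`, `ay|xB`); the percolation input is ONE
  instance of the two-cluster exchange inequality (`Literature…twoClusterExchange`, BHK 2006 Thm 1.5)
  with `s = x`, `t = y`: `A₁ = {a ∈ C_x}`, `B₁ = {x small, y big}`, `A₂ = {y small, x big}`,
  `B₂ = {a ∈ C_y}`, giving `p_x · p_y ≤ q_y · q_x` for `p_x = P(a ~ x, x small, y big)`,
  `q_x = P(a ~ y, y big, x small)` (and symmetrically); hence `p_y ≤ q_x` or `p_x ≤ q_y`, and in either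
  case the bookkeeping `P(a small, a ↮ x, a ↮ y) ≥ P(x small) − P(T_a = {a,x}) − P(T_a = {a,y})
  ≥ P(T_x ∪ T_y ⊆ {x,y}) + q_x − p_y` (resp. with `y`) closes.
  Consequence (paper, report CST-gen3.md of prim-cplus-engine): the level-2 cumulative-isolation bound
  `P(1 ≤ N ≤ 2) ≤ P(o ↔ A, T_a small) ≤ max_a P(|T_a| ≤ 2)` for every observer all of whose neighbours
  are relays and every `|A|` (condition on the relays joined to `o`; groups of size 1, 2, ≥ 3 are handled by
  the champion property, this lemma, and triviality).
-/

namespace Summit.CriticalPhenomena.PercolationContinuityZ3.Theorems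

open scoped BigOperators Classical
open MeasureTheory Set
open Literature.Probability.LatticeModels (prodBernoulli)
open Literature.Probability.Percolation

variable {n : ℕ}

namespace MergeLemmaTwo

/-- If `x ↔ a` then the relay classes of `a` and `x` coincide. [folklore] -/
theorem filter_eq_of_conn (A : Finset (Fin n)) {x a : Fin n} {ω : BondConfig (Fin n)}
    (h : ω ∈ (openConn x a : Set (BondConfig (Fin n)))) :
    (A.filter fun u => ω ∈ (openConn a u : Set (BondConfig (Fin n)))) =
      A.filter fun u => ω ∈ (openConn x u : Set (BondConfig (Fin n))) := by
  have hxa : (openGraph ω).Reachable x a := h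
  ext u
  simp only [Finset.mem_filter, and_congr_right_iff]
  intro _
  constructor
  · intro hau
    have hau' : (openGraph ω).Reachable a u := hau
    exact hxa.trans hau'
  · intro hxu
    have hxu' : (openGraph ω).Reachable x u := hxu
    exact hxa.symm.trans hxu'

/-- If `x ↔ a` and `y ↔ a` with `a, x, y ∈ A` distinct, then the relay class of `x` has at least three
elements (`x, y, a`). [folklore] -/
theorem three_le_card_of_conn (A : Finset (Fin n)) {a x y : Fin n} (ha : a ∈ A) (hx : x ∈ A)
    (hy : y ∈ A) (hax : a ≠ x) (hay : a ≠ y) (hxy : x ≠ y) {ω : BondConfig (Fin n)}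
    (h1 : ω ∈ (openConn x a : Set (BondConfig (Fin n))))
    (h2 : ω ∈ (openConn y a : Set (BondConfig (Fin n)))) :
    3 ≤ (A.filter fun u => ω ∈ (openConn x u : Set (BondConfig (Fin n)))).card := by
  have hxa : (openGraph ω).Reachable x a := h1
  have hya : (openGraph ω).Reachable y a := h2
  have hsub : ({a, x, y} : Finset (Fin n)) ⊆
      A.filter fun u => ω ∈ (openConn x u : Set (BondConfig (Fin n))) := by
    intro u hu
    simp only [Finset.mem_insert, Finset.mem_singleton] at hu
    rw [Finset.mem_filter]
    rcases hu with rfl | rfl | rfl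
    · exact ⟨ha, hxa⟩
    · exact ⟨hx, (SimpleGraph.Reachable.refl u : (openGraph ω).Reachable u u)⟩
    · exact ⟨hy, hxa.trans hya.symm⟩
  have hcard : ({a, x, y} : Finset (Fin n)).card = 3 := by
    rw [Finset.card_insert_of_notMem, Finset.card_pair hxy]
    simp only [Finset.mem_insert, Finset.mem_singleton, not_or]
    exact ⟨hax, hay⟩
  calc 3 = ({a, x, y} : Finset (Fin n)).card := hcard.symm
    _ ≤ _ := Finset.card_le_card hsub

/-- If the classes of `x` and `y` differ in size (one `≤ 2`, the other `> 2`) then `x ↮ y`. [folklore] -/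
theorem not_conn_of_small_big (A : Finset (Fin n)) {x y : Fin n} {ω : BondConfig (Fin n)}
    (hx : (A.filter fun u => ω ∈ (openConn x u : Set (BondConfig (Fin n)))).card ≤ 2)
    (hy : ¬ (A.filter fun u => ω ∈ (openConn y u : Set (BondConfig (Fin n)))).card ≤ 2) :
    ω ∈ (openConn x y : Set (BondConfig (Fin n)))ᶜ := by
  intro hxy
  have hxy' : ω ∈ (openConn y x : Set (BondConfig (Fin n))) :=
    (show (openGraph ω).Reachable x y from hxy).symm
  rw [filter_eq_of_conn A hxy'] at hx
  exact hy hx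

end MergeLemmaTwo

open MergeLemmaTwo in
/-- **MERGE LEMMA (level 2).**  For bond percolation with arbitrary edge probabilities on `Fin n`, a
relay set `A` and distinct relays `a, x, y ∈ A`, with `T_v = {u ∈ A : v ↔ u}`: if
`P(|T_x| ≤ 2) ≤ P(|T_a| ≤ 2)` and `P(|T_y| ≤ 2) ≤ P(|T_a| ≤ 2)` (the relay `a` beats `x` and `y` at
level 2), then
`P(x and y are joined to no other relay) ≤ P(|T_a| ≤ 2, x ↮ a, y ↮ a)`
— i.e. after gluing `x` to `y` the relay `a` still beats the glued pair at level 2.  Proof: one instance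
of the two-cluster exchange inequality (BHK 2006 Thm 1.5) gives
`P(a~x, x sm, y big)·P(a~y, y sm, x big) ≤ P(a~x, y sm, x big)·P(a~y, x sm, y big)`, whence one of the two
bookkeeping chains (via the hypothesis for `x` or for `y`) closes.
[cite: VandenbergHaggstromKahn2005, Thm. 1.5 (p. 7) — via `Literature…twoClusterExchange`] -/
theorem mergeLemma_two (n : ℕ) (w : Sym2 (Fin n) → unitInterval) (A : Finset (Fin n))
    (a x y : Fin n) (ha : a ∈ A) (hx : x ∈ A) (hy : y ∈ A) (hax : a ≠ x) (hay : a ≠ y)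
    (hxy : x ≠ y)
    (hbx : (prodBernoulli w).real
        {ω : BondConfig (Fin n) | (A.filter fun u => ω ∈ openConn x u).card ≤ 2} ≤
      (prodBernoulli w).real
        {ω : BondConfig (Fin n) | (A.filter fun u => ω ∈ openConn a u).card ≤ 2})
    (hby : (prodBernoulli w).real
        {ω : BondConfig (Fin n) | (A.filter fun u => ω ∈ openConn y u).card ≤ 2} ≤
      (prodBernoulli w).real
        {ω : BondConfig (Fin n) | (A.filter fun u => ω ∈ openConn a u).card ≤ 2}) :
    (prodBernoulli w).real {ω : BondConfig (Fin n) |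
        ∀ u ∈ A, u ≠ x → u ≠ y → ω ∉ openConn x u ∧ ω ∉ openConn y u} ≤
      (prodBernoulli w).real
        ({ω : BondConfig (Fin n) | (A.filter fun u => ω ∈ openConn a u).card ≤ 2} ∩
          (openConn x a)ᶜ ∩ (openConn y a)ᶜ) := by
  set μ := prodBernoulli w with hμ
  -- the events
  set Sa : Set (BondConfig (Fin n)) :=
    {ω | (A.filter fun u => ω ∈ openConn a u).card ≤ 2} with hSa
  set Sx : Set (BondConfig (Fin n)) :=
    {ω | (A.filter fun u => ω ∈ openConn x u).card ≤ 2} with hSx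
  set Sy : Set (BondConfig (Fin n)) :=
    {ω | (A.filter fun u => ω ∈ openConn y u).card ≤ 2} with hSy
  set Cxa : Set (BondConfig (Fin n)) := openConn x a with hCxa
  set Cya : Set (BondConfig (Fin n)) := openConn y a with hCya
  set EU : Set (BondConfig (Fin n)) :=
    {ω | ∀ u ∈ A, u ≠ x → u ≠ y → ω ∉ openConn x u ∧ ω ∉ openConn y u} with hEU
  set D : Set (BondConfig (Fin n)) := (openConn x y)ᶜ with hD
  -- the four exchange quantities
  set px : ℝ := μ.real (Cxa ∩ Sx ∩ Syᶜ) with hpx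
  set py : ℝ := μ.real (Cya ∩ Sy ∩ Sxᶜ) with hpy
  set qx : ℝ := μ.real (Cya ∩ Sx ∩ Syᶜ) with hqx
  set qy : ℝ := μ.real (Cxa ∩ Sy ∩ Sxᶜ) with hqy
  have hms : ∀ s : Set (BondConfig (Fin n)), MeasurableSet s := fun _ => MeasurableSet.of_discrete
  /- (1) `Sa ⊆ (Sa ∩ Cxaᶜ ∩ Cyaᶜ) ∪ (Cxa ∩ Sx) ∪ (Cya ∩ Sy)` (on `Cxa`, `T_a = T_x`). -/
  have h1 : μ.real Sa ≤ μ.real (Sa ∩ Cxaᶜ ∩ Cyaᶜ) + μ.real (Cxa ∩ Sx) + μ.real (Cya ∩ Sy) := by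
    have hsub : Sa ⊆ (Sa ∩ Cxaᶜ ∩ Cyaᶜ) ∪ (Cxa ∩ Sx) ∪ (Cya ∩ Sy) := by
      intro ω hω
      by_cases h1 : ω ∈ Cxa
      · refine Or.inl (Or.inr ⟨h1, ?_⟩)
        have : (A.filter fun u => ω ∈ openConn a u).card ≤ 2 := hω
        rw [filter_eq_of_conn A h1] at this
        exact this
      by_cases h2 : ω ∈ Cya
      · refine Or.inr ⟨h2, ?_⟩
        have : (A.filter fun u => ω ∈ openConn a u).card ≤ 2 := hω
        rw [filter_eq_of_conn A h2] at this
        exact this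
      exact Or.inl (Or.inl ⟨⟨hω, h1⟩, h2⟩)
    calc μ.real Sa ≤ μ.real ((Sa ∩ Cxaᶜ ∩ Cyaᶜ) ∪ (Cxa ∩ Sx) ∪ (Cya ∩ Sy)) := measureReal_mono hsub
      _ ≤ μ.real ((Sa ∩ Cxaᶜ ∩ Cyaᶜ) ∪ (Cxa ∩ Sx)) + μ.real (Cya ∩ Sy) := measureReal_union_le _ _
      _ ≤ μ.real (Sa ∩ Cxaᶜ ∩ Cyaᶜ) + μ.real (Cxa ∩ Sx) + μ.real (Cya ∩ Sy) := by
          gcongr; exact measureReal_union_le _ _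
  /- (2) `EU`, `Cxa ∩ Sx`, `Cya ∩ Sx` are pairwise disjoint subsets of `Sx`; symmetrically for `Sy`. -/
  have hEU_sub : ∀ {z : Fin n}, (z = x ∨ z = y) →
      EU ⊆ {ω : BondConfig (Fin n) | (A.filter fun u => ω ∈ openConn z u).card ≤ 2} := by
    intro z hz ω hω
    have hsub : (A.filter fun u => ω ∈ openConn z u) ⊆ {x, y} := by
      intro u hu
      rw [Finset.mem_filter] at hu
      rw [Finset.mem_insert, Finset.mem_singleton]
      rcases eq_or_ne u x with hux | hux
      · exact Or.inl hux
      rcases eq_or_ne u y with huy | huy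
      · exact Or.inr huy
      exfalso
      have := hω u hu.1 hux huy
      rcases hz with rfl | rfl
      · exact this.1 hu.2
      · exact this.2 hu.2
    calc (A.filter fun u => ω ∈ openConn z u).card ≤ ({x, y} : Finset (Fin n)).card :=
          Finset.card_le_card hsub
      _ = 2 := Finset.card_pair hxy
  have hEU_disj : ∀ {z : Fin n}, (z = x ∨ z = y) → ∀ (S : Set (BondConfig (Fin n))),
      Disjoint EU ((openConn z a : Set (BondConfig (Fin n))) ∩ S) := by
    intro z hz S
    rw [Set.disjoint_left]
    rintro ω hω ⟨hza, _⟩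
    have := hω a ha hax hay
    rcases hz with rfl | rfl
    · exact this.1 hza
    · exact this.2 hza
  have hG_disj : Disjoint (Cxa ∩ Sx) (Cya ∩ Sx) := by
    rw [Set.disjoint_left]
    rintro ω ⟨h1, h2⟩ ⟨h3, _⟩
    have h3' := three_le_card_of_conn A ha hx hy hax hay hxy h1 h3
    have h2' : (A.filter fun u => ω ∈ openConn x u).card ≤ 2 := h2
    omega
  have hG_disj' : Disjoint (Cya ∩ Sy) (Cxa ∩ Sy) := by
    rw [Set.disjoint_left]
    rintro ω ⟨h1, h2⟩ ⟨h3, _⟩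
    have h3' := three_le_card_of_conn A ha hy hx hay hax (Ne.symm hxy) h1 h3
    have h2' : (A.filter fun u => ω ∈ openConn y u).card ≤ 2 := h2
    omega
  have h2x : μ.real EU + μ.real (Cxa ∩ Sx) + μ.real (Cya ∩ Sx) ≤ μ.real Sx := by
    have hd1 : Disjoint EU (Cxa ∩ Sx) := hEU_disj (Or.inl rfl) Sx
    have hd2 : Disjoint (EU ∪ (Cxa ∩ Sx)) (Cya ∩ Sx) :=
      Set.disjoint_union_left.2 ⟨hEU_disj (Or.inr rfl) Sx, hG_disj⟩
    rw [← measureReal_union hd1 (hms _), ← measureReal_union hd2 (hms _)]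
    refine measureReal_mono ?_
    refine Set.union_subset (Set.union_subset (hEU_sub (Or.inl rfl)) Set.inter_subset_right)
      Set.inter_subset_right
  have h2y : μ.real EU + μ.real (Cya ∩ Sy) + μ.real (Cxa ∩ Sy) ≤ μ.real Sy := by
    have hd1 : Disjoint EU (Cya ∩ Sy) := hEU_disj (Or.inr rfl) Sy
    have hd2 : Disjoint (EU ∪ (Cya ∩ Sy)) (Cxa ∩ Sy) :=
      Set.disjoint_union_left.2 ⟨hEU_disj (Or.inl rfl) Sy, hG_disj'⟩
    rw [← measureReal_union hd1 (hms _), ← measureReal_union hd2 (hms _)]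
    refine measureReal_mono ?_
    refine Set.union_subset (Set.union_subset (hEU_sub (Or.inr rfl)) Set.inter_subset_right)
      Set.inter_subset_right
  /- (3) splitting `Cya ∩ Sx`, `Cya ∩ Sy`, `Cxa ∩ Sy`, `Cxa ∩ Sx` along the other smallness event. -/
  have h3a : μ.real (Cya ∩ Sx) = μ.real (Cya ∩ Sx ∩ Sy) + qx := by
    rw [hqx, ← measureReal_inter_add_sdiff (s := Cya ∩ Sx) (hms Sy), Set.sdiff_eq]
  have h3b : μ.real (Cya ∩ Sy) = μ.real (Cya ∩ Sy ∩ Sx) + py := by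
    rw [hpy, ← measureReal_inter_add_sdiff (s := Cya ∩ Sy) (hms Sx), Set.sdiff_eq]
  have h3c : μ.real (Cxa ∩ Sy) = μ.real (Cxa ∩ Sy ∩ Sx) + qy := by
    rw [hqy, ← measureReal_inter_add_sdiff (s := Cxa ∩ Sy) (hms Sx), Set.sdiff_eq]
  have h3d : μ.real (Cxa ∩ Sx) = μ.real (Cxa ∩ Sx ∩ Sy) + px := by
    rw [hpx, ← measureReal_inter_add_sdiff (s := Cxa ∩ Sx) (hms Sy), Set.sdiff_eq]
  have hcomm1 : μ.real (Cya ∩ Sx ∩ Sy) = μ.real (Cya ∩ Sy ∩ Sx) := by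
    rw [Set.inter_right_comm]
  have hcomm2 : μ.real (Cxa ∩ Sy ∩ Sx) = μ.real (Cxa ∩ Sx ∩ Sy) := by
    rw [Set.inter_right_comm]
  /- (4) the exchange inequality: `px * py ≤ qy * qx`. -/
  have h4 : px * py ≤ qy * qx := by
    -- type (+): closed under enlarging `C_x`, shrinking `C_y`; type (−): the reverse
    have hSmall_shrink : ∀ (z : Fin n) ⦃ω ω' : BondConfig (Fin n)⦄,
        openEdgeCluster ω' z ⊆ openEdgeCluster ω z →
        (A.filter fun u => ω ∈ openConn z u).card ≤ 2 →
        (A.filter fun u => ω' ∈ openConn z u).card ≤ 2 := by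
      intro z ω ω' hz h
      refine le_trans (Finset.card_le_card ?_) h
      intro u hu
      rw [Finset.mem_filter] at hu ⊢
      refine ⟨hu.1, ?_⟩
      change (openGraph ω).Reachable z u
      rw [reachable_iff_exists_mem_openEdgeCluster]
      rcases (reachable_iff_exists_mem_openEdgeCluster ω' z u).1 hu.2 with h1 | ⟨e, he, hue⟩
      · exact Or.inl h1
      · exact Or.inr ⟨e, hz he, hue⟩
    have hBig_grow : ∀ (z : Fin n) ⦃ω ω' : BondConfig (Fin n)⦄,
        openEdgeCluster ω z ⊆ openEdgeCluster ω' z →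
        ¬ (A.filter fun u => ω ∈ openConn z u).card ≤ 2 →
        ¬ (A.filter fun u => ω' ∈ openConn z u).card ≤ 2 := by
      intro z ω ω' hz h h'
      exact h (hSmall_shrink z hz h')
    have key := twoClusterExchange (V := Fin n) w hxy
      (A₁ := Cxa) (A₂ := Sy ∩ Sxᶜ) (B₁ := Sx ∩ Syᶜ) (B₂ := Cya) ?_ ?_ ?_ ?_
    rotate_left
    · intro ω ω' hs ht hω
      exact typePlus_openConn x y a hs ht hω
    · intro ω ω' hs ht hω
      exact ⟨hSmall_shrink y ht hω.1, hBig_grow x hs hω.2⟩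
    · intro ω ω' hs ht hω
      exact ⟨hSmall_shrink x hs hω.1, hBig_grow y ht hω.2⟩
    · intro ω ω' hs ht hω
      exact typeMinus_openConn x y a hs ht hω
    -- `D` is automatic in all four events
    have e1 : D ∩ (Cxa ∩ (Sx ∩ Syᶜ)) = Cxa ∩ Sx ∩ Syᶜ := by
      ext ω
      simp only [Set.mem_inter_iff]
      constructor
      · rintro ⟨_, h1, h2, h3⟩; exact ⟨⟨h1, h2⟩, h3⟩
      · rintro ⟨⟨h1, h2⟩, h3⟩; exact ⟨not_conn_of_small_big A h2 h3, h1, h2, h3⟩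
    have e2 : D ∩ (Sy ∩ Sxᶜ ∩ Cya) = Cya ∩ Sy ∩ Sxᶜ := by
      ext ω
      simp only [Set.mem_inter_iff]
      constructor
      · rintro ⟨_, ⟨h1, h2⟩, h3⟩; exact ⟨⟨h3, h1⟩, h2⟩
      · rintro ⟨⟨h3, h1⟩, h2⟩
        refine ⟨?_, ⟨h1, h2⟩, h3⟩
        have := not_conn_of_small_big A h1 h2
        intro hc
        exact this (show (openGraph ω).Reachable y x from (show (openGraph ω).Reachable x y from hc).symm)
    have e3 : D ∩ (Cxa ∩ (Sy ∩ Sxᶜ)) = Cxa ∩ Sy ∩ Sxᶜ := by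
      ext ω
      simp only [Set.mem_inter_iff]
      constructor
      · rintro ⟨_, h1, h2, h3⟩; exact ⟨⟨h1, h2⟩, h3⟩
      · rintro ⟨⟨h1, h2⟩, h3⟩
        refine ⟨?_, h1, h2, h3⟩
        have := not_conn_of_small_big A h2 h3
        intro hc
        exact this (show (openGraph ω).Reachable y x from (show (openGraph ω).Reachable x y from hc).symm)
    have e4 : D ∩ (Sx ∩ Syᶜ ∩ Cya) = Cya ∩ Sx ∩ Syᶜ := by
      ext ω
      simp only [Set.mem_inter_iff]
      constructor
      · rintro ⟨_, ⟨h1, h2⟩, h3⟩; exact ⟨⟨h3, h1⟩, h2⟩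
      · rintro ⟨⟨h3, h1⟩, h2⟩; exact ⟨not_conn_of_small_big A h1 h2, ⟨h1, h2⟩, h3⟩
    have hD : ((openConn x y : Set (BondConfig (Fin n)))ᶜ) = D := rfl
    rw [hD, e1, e2, e3, e4] at key
    simpa only [hpx, hpy, hqx, hqy] using key
  /- (5) the dichotomy and the two bookkeeping chains. -/
  have hpx0 : 0 ≤ px := measureReal_nonneg
  have hpy0 : 0 ≤ py := measureReal_nonneg
  have hqx0 : 0 ≤ qx := measureReal_nonneg
  have hqy0 : 0 ≤ qy := measureReal_nonneg
  by_cases hcase : py ≤ qx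
  · -- chain via the hypothesis for `x`
    linarith [h1, h2x, h3a, h3b, hcomm1, hbx]
  · have hcase' : px ≤ qy := by
      by_contra hcon
      have h1' := lt_of_not_ge hcase
      have h2' := lt_of_not_ge hcon
      nlinarith
    -- chain via the hypothesis for `y`
    linarith [h1, h2y, h3c, h3d, hcomm2, hby]

end Summit.CriticalPhenomena.PercolationContinuityZ3.Theorems
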